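import Mathlib
import Summits.PneNP.PneNP.Theorems.KarlinRubinMonotoneSufficesTransportSlices

/-!
# Crux `MonotoneSuffices` (stmt-PneNP-18026), line `Sketch` — mixture-shift rung, stub
# `stub_mixtureCollision` (M2): the collision identity of a mixture of up-shifts

On the cube `α → Bool` (`supp y = {a | y a}`, `N = |α|`, uniform law `μ`) the UP-SHIFT by a random set
`R` from a finite family `Rs` has law `ν` with density
`ρ(y) = (dν/dμ)(y) = (1/#Rs) ∑_{R ∈ Rs, R ⊆ supp y} 2^{#R}`.  Its second moment (the COLLISION number)
is `E_μ[ρ²] = E_{R,R'} 2^{#(R ∩ R')}`; in counting form: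

* `mixtureCollision_card_filter_supset` — `#{y | K ⊆ supp y} = 2^{N - #K}` (from
  `SliceTransport.sum_plant_eq`: planting `K` is `2^{#K}`-to-one onto these vectors);
* `mixtureCollision_sum_pair` — for fixed `R, R'`,
  `∑_y [R ⊆ supp y] 2^{#R} · [R' ⊆ supp y] 2^{#R'} = 2^{#R + #R'} · 2^{N - #(R ∪ R')} = 2^N · 2^{#(R ∩ R')}`;
* `stub_mixtureCollision` — expanding the square and swapping sums,
  `∑_y (∑_{R ∈ Rs, R ⊆ supp y} 2^{#R})² = 2^N · ∑_{R,R' ∈ Rs} 2^{#(R ∩ R')}`.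
-/

set_option linter.dupNamespace false -- `Summit.PneNP.PneNP.…`: summit = sub-problem name (D-0017)

namespace Summit.PneNP.PneNP.Theorems.MonotoneSuffices.DensityShift

open Finset

variable {α : Type*} [Fintype α] [DecidableEq α]

/-- **The vectors containing a fixed set `K` number `2^{N - #K}`**:
`#{y | K ⊆ supp y} = 2^{N - #K}` (planting `K` is `2^{#K}`-to-one from all `2^N` vectors onto them).
[folklore] -/
theorem mixtureCollision_card_filter_supset (K : Finset α) :
    #((univ : Finset (α → Bool)).filter fun y => K ⊆ univ.filter fun a => y a = true) =
      2 ^ (Fintype.card α - #K) := by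
  classical
  have h := SliceTransport.sum_plant_eq K (fun _ => (1 : ℝ))
  simp only [sum_const, card_univ, Fintype.card_fun, Fintype.card_bool, nsmul_eq_mul, mul_one] at h
  have hK : #K ≤ Fintype.card α := card_le_univ K
  have hpow : ((2 ^ Fintype.card α : ℕ) : ℝ) = (2 : ℝ) ^ #K * (2 : ℝ) ^ (Fintype.card α - #K) := by
    rw [← pow_add, Nat.add_sub_cancel' hK]
    push_cast
    rfl
  have h2 : (2 : ℝ) ^ #K ≠ 0 := by positivity
  have h3 := mul_left_cancel₀ h2 (h.symm.trans hpow)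
  exact_mod_cast h3

/-- **The pair term of the collision sum**: for fixed `R, R'`,
`∑_y [R ⊆ supp y] 2^{#R} · [R' ⊆ supp y] 2^{#R'} = 2^N · 2^{#(R ∩ R')}`, since both conditions say
`R ∪ R' ⊆ supp y` (`2^{N - #(R ∪ R')}` vectors) and `#R + #R' = #(R ∪ R') + #(R ∩ R')`. [folklore] -/
theorem mixtureCollision_sum_pair (R R' : Finset α) :
    ∑ y : α → Bool, (if R ⊆ univ.filter (fun a => y a = true) then 2 ^ #R else 0) *
        (if R' ⊆ univ.filter (fun a => y a = true) then 2 ^ #R' else 0) =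
      2 ^ Fintype.card α * 2 ^ #(R ∩ R') := by
  have h1 : ∀ y : α → Bool, (if R ⊆ univ.filter (fun a => y a = true) then 2 ^ #R else 0) *
        (if R' ⊆ univ.filter (fun a => y a = true) then 2 ^ #R' else 0) =
      if R ∪ R' ⊆ univ.filter (fun a => y a = true) then 2 ^ #R * 2 ^ #R' else 0 := by
    intro y
    by_cases hR : R ⊆ univ.filter (fun a => y a = true) <;>
      by_cases hR' : R' ⊆ univ.filter (fun a => y a = true) <;> simp [hR, hR', union_subset_iff]
  simp_rw [h1]
  rw [← sum_filter, sum_const, smul_eq_mul, mixtureCollision_card_filter_supset]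
  have hui := card_union_add_card_inter R R'
  have hle : #(R ∪ R') ≤ Fintype.card α := card_le_univ _
  calc 2 ^ (Fintype.card α - #(R ∪ R')) * (2 ^ #R * 2 ^ #R')
      = 2 ^ (Fintype.card α - #(R ∪ R') + (#R + #R')) := by rw [pow_add, pow_add]
    _ = 2 ^ (Fintype.card α + #(R ∩ R')) := by
        congr 1
        omega
    _ = 2 ^ Fintype.card α * 2 ^ #(R ∩ R') := pow_add _ _ _

/-- **M2, the collision identity** (registered stub of stmt-PneNP-18026, line `Sketch`,
mixture-shift rung): `E_μ[(dν/dμ)²] = E_{R,R'} 2^{#(R ∩ R')}` in counting form,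
`∑_y (∑_{R ∈ Rs, R ⊆ supp y} 2^{#R})² = 2^N · ∑_{R ∈ Rs} ∑_{R' ∈ Rs} 2^{#(R ∩ R')}`. [folklore] -/
theorem stub_mixtureCollision :
    ∀ {α : Type*} [Fintype α] [DecidableEq α] (Rs : Finset (Finset α)),
      ∑ y : α → Bool, (∑ R ∈ Rs.filter (fun R => R ⊆ univ.filter fun a => y a = true), 2 ^ #R) ^ 2 =
        2 ^ Fintype.card α * ∑ R ∈ Rs, ∑ R' ∈ Rs, 2 ^ #(R ∩ R') := by
  intro α _ _ Rs
  calc ∑ y : α → Bool, (∑ R ∈ Rs.filter (fun R => R ⊆ univ.filter fun a => y a = true), 2 ^ #R) ^ 2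
      = ∑ y : α → Bool, ∑ R ∈ Rs, ∑ R' ∈ Rs,
          (if R ⊆ univ.filter (fun a => y a = true) then 2 ^ #R else 0) *
            (if R' ⊆ univ.filter (fun a => y a = true) then 2 ^ #R' else 0) := by
        refine sum_congr rfl fun y _ => ?_
        rw [sum_filter, sq, sum_mul_sum]
    _ = ∑ R ∈ Rs, ∑ y : α → Bool, ∑ R' ∈ Rs,
          (if R ⊆ univ.filter (fun a => y a = true) then 2 ^ #R else 0) *
            (if R' ⊆ univ.filter (fun a => y a = true) then 2 ^ #R' else 0) := sum_comm
    _ = ∑ R ∈ Rs, ∑ R' ∈ Rs, ∑ y : α → Bool,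
          (if R ⊆ univ.filter (fun a => y a = true) then 2 ^ #R else 0) *
            (if R' ⊆ univ.filter (fun a => y a = true) then 2 ^ #R' else 0) :=
        sum_congr rfl fun R _ => sum_comm
    _ = ∑ R ∈ Rs, ∑ R' ∈ Rs, 2 ^ Fintype.card α * 2 ^ #(R ∩ R') :=
        sum_congr rfl fun R _ => sum_congr rfl fun R' _ => mixtureCollision_sum_pair R R'
    _ = 2 ^ Fintype.card α * ∑ R ∈ Rs, ∑ R' ∈ Rs, 2 ^ #(R ∩ R') := by
        rw [mul_sum]
        exact sum_congr rfl fun R _ => (mul_sum _ _ _).symm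

end Summit.PneNP.PneNP.Theorems.MonotoneSuffices.DensityShift
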